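import Literature.AlgebraicGeometry.Motives.ProjectiveSpaceLinearSubspaceDegree
import Literature.AlgebraicGeometry.Motives.CartierDivisorChowClass
import HarnessLib

/-!
# A hypersurface of degree `e` in `ℙᴺ` has degree `e` (Fulton, §2.5, Example 2.5.2)

Fulton, *Intersection Theory* (2nd ed. 1998), §2.5: the degree of a `k`-cycle `α` on `ℙⁿ` is
`deg α = ∫ c₁(𝒪(1))ᵏ ∩ α`, and a hypersurface `V₊(F)`, `F` a form of degree `e`, satisfies
`𝒪(V₊(F)) ≅ 𝒪(e)`, so `[V₊(F)] = e · [H]` in `A_{n-1}(ℙⁿ) = ℤ · [H]` and `deg V₊(F) = e`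
(Example 2.5.2 / Example 1.9.3). In the tree's vocabulary — the Cartier divisor
`ProjSpace.formDivisor F` of a form (`Motives/ProjectiveSpaceFormDivisors`), its Weil divisor class
`CartierDivisor.chowClass` (`Motives/CartierDivisorChowClass`, Fulton §2.1), and the degree
isomorphism `ProjSpace.degreeEquiv : CH_r(ℙᴺ_K) ≃+ ℤ` (`Motives/ProjectiveSpaceLinearSubspaceDegree`):

* `ProjSpace.height_top_succ` — `dim ℙ^{d+1} = d + 1`;
* `ProjSpace.toIdeal_coordGenericPoint_eq_span` / `coheight_coordGenericPoint_eq_one` — the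
  coordinate hyperplane point `λ_d` of `ℙ^{d+1}` has homogeneous prime `(x_{d+1})` and codimension
  one, so `[V₊(x_{d+1})] = [λ_d]` (`cycle_formDivisor_eq_primeCycle`,
  `Motives/ProjectiveSpaceHyperplaneMultiplicity`);
* `ProjSpace.chowClass_formDivisor_eq_smul` — **`[V₊(F)] = e • [λ_d]` in `CH_d(ℙ^{d+1}_K)`** for a
  nonzero form `F` of degree `e` (`𝒪(V₊(F)) ∼ e H ∼ e V₊(x_{d+1})`, Fulton §2.1: linearly equivalent
  divisors have the same class);
* `ProjSpace.degreeEquiv_chowClass_formDivisor` — **`deg [V₊(F)] = e`** (`K` algebraically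
  closed): the Weil divisor of a degree-`e` form — the hypersurface counted with the multiplicities of
  the factors of `F` — has degree `e`.

Everything is proved; no definitions, no named facts.

## References

* W. Fulton, *Intersection Theory*, 2nd ed., Springer (1998): §2.5, Examples 2.5.1–2.5.2 (p. 41),
  Example 1.9.3 (p. 23), §2.1 (pp. 30–31). [Fulton1998]
-/

noncomputable section

universe u

open CategoryTheory AlgebraicGeometry Order
open MvPolynomial (X)
open Literature.AlgebraicGeometry.Motives.Segre

attribute [local instance] MvPolynomial.gradedAlgebra

namespace Literature.AlgebraicGeometry.Motives

namespace ProjSpace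

variable {K : Type u} [Field K] {d : ℕ}

/-- **`dim ℙ^{d+1}_K = d + 1`**: the generic point of `ℙ^{d+1}` has height `d + 1`
(`height + coheight = d + 1` on the smooth `(d+1)`-fold `ℙ^{d+1}`). [folklore] -/
theorem height_top_succ : height (⊤ : ↥(projectiveSpace (d + 1) K).left) = d + 1 := by
  haveI := (isSmoothProjective_projectiveSpace_holds K (d + 1)).smoothOfRelativeDimension
  have hsum := height_add_coheight_eq_of_smoothOfRelativeDimension (projectiveSpace (d + 1) K).hom
    (d + 1) (⊤ : ↥(projectiveSpace (d + 1) K).left)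
  rw [coheight_top, add_zero] at hsum
  exact_mod_cast hsum

/-- The homogeneous prime of the coordinate hyperplane point `λ_d ∈ ℙ^{d+1}` is `(x_{d+1})`.
[folklore] -/
theorem toIdeal_coordGenericPoint_eq_span :
    (ProjectiveSpectrum.asHomogeneousIdeal (𝒜 := MvPolynomial.homogeneousSubmodule (Fin (d + 1 + 1)) K)
      (ProjectiveSpaceCells.coordGenericPoint K (n := d + 1) d)).toIdeal =
      Ideal.span {(X (Fin.last (d + 1)) : MvPolynomial (Fin (d + 1 + 1)) K)} := by
  change (ProjectiveSpectrum.asHomogeneousIdeal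
    (𝒜 := MvPolynomial.homogeneousSubmodule (Fin (d + 1 + 1)) K)
    (linearSubspacePoint (ProjectiveSpaceCells.coordForms K (d + 1) d)
      (ProjectiveSpaceCells.linearIndependent_coordForms K (d + 1) d)
      (ProjectiveSpaceCells.isHomogeneous_coordForms K (d + 1) d) (Nat.sub_le (d + 1) d))).toIdeal = _
  rw [toIdeal_linearSubspacePoint, ProjectiveSpaceCells.range_coordForms]
  congr 1
  ext f
  simp only [Set.mem_image, Set.mem_setOf_eq, Set.mem_singleton_iff]
  constructor
  · rintro ⟨j, hj, rfl⟩
    congr 1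
    exact Fin.ext (by simp only [Fin.val_last]; omega)
  · rintro rfl
    exact ⟨Fin.last (d + 1), by simp, rfl⟩

/-- The coordinate hyperplane point `λ_d ∈ ℙ^{d+1}` has codimension one. [folklore] -/
theorem coheight_coordGenericPoint_eq_one :
    coheight (ProjectiveSpaceCells.coordGenericPoint K (n := d + 1) d) = 1 := by
  change coheight (linearSubspacePoint (ProjectiveSpaceCells.coordForms K (d + 1) d)
      (ProjectiveSpaceCells.linearIndependent_coordForms K (d + 1) d)
      (ProjectiveSpaceCells.isHomogeneous_coordForms K (d + 1) d) (Nat.sub_le (d + 1) d)) = 1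
  rw [coheight_linearSubspacePoint, Nat.add_sub_cancel_left, Nat.cast_one]

/-- **`[V₊(x_{d+1})] = [λ_d]`**: the Weil divisor of the coordinate hyperplane of `ℙ^{d+1}` is the
prime cycle of the coordinate hyperplane point (multiplicity one,
`cycle_formDivisor_eq_primeCycle`). [cite: Fulton1998, Example 2.5.1 (p. 41)] -/
theorem cycle_formDivisor_X_last :
    (formDivisor (X (Fin.last (d + 1)) : MvPolynomial (Fin (d + 1 + 1)) K) (X_mem K _)
        (MvPolynomial.X_ne_zero _)).cycle =
      primeCycle (ProjectiveSpaceCells.coordGenericPoint K (n := d + 1) d) :=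
  cycle_formDivisor_eq_primeCycle (X_mem K _) (MvPolynomial.X_ne_zero _)
    toIdeal_coordGenericPoint_eq_span coheight_coordGenericPoint_eq_one

/-- **`[V₊(F)] = e • [λ_d]` in `CH_d(ℙ^{d+1}_K)`** for a nonzero form `F` of degree `e`: the class
of the Weil divisor of `V₊(F)` is `e` times the class of a hyperplane (Fulton §2.5 / Example 1.9.3:
`𝒪(V₊(F)) ≅ 𝒪(e)`, and linearly equivalent divisors have equal classes, §2.1).
[cite: Fulton1998, §2.1 (pp. 30–31) and Example 1.9.3 (p. 23)] -/
theorem chowClass_formDivisor_eq_smul {e : ℕ} {F : MvPolynomial (Fin (d + 1 + 1)) K}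
    (hF : F ∈ grading (Fin (d + 1 + 1)) K e) (hF0 : F ≠ 0) :
    (formDivisor F hF hF0).chowClass (V := projectiveSpace (d + 1) K) height_top_succ =
      e • ChowGroup.ofPoint (X := (projectiveSpace (d + 1) K).left)
        (ProjectiveSpaceCells.coordGenericPoint K (n := d + 1) d)
        (ProjectiveSpaceCells.height_coordGenericPoint K (Nat.le_succ d)) := by
  have hV : height (⊤ : ↥(projectiveSpace (d + 1) K).left) = d + 1 := height_top_succ
  have h1 : (formDivisor F hF hF0).chowClass (V := projectiveSpace (d + 1) K) hV =
      (e • hyperplane (d + 1) K).chowClass (V := projectiveSpace (d + 1) K) hV :=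
    ((smul_hyperplane_linEquiv_formDivisor hF hF0).chowClass_eq (V := projectiveSpace (d + 1) K) hV).symm
  have h2 : (e • hyperplane (d + 1) K).chowClass (V := projectiveSpace (d + 1) K) hV =
      e • (hyperplane (d + 1) K).chowClass (V := projectiveSpace (d + 1) K) hV :=
    CartierDivisor.chowClass_smul (V := projectiveSpace (d + 1) K) hV (hyperplane (d + 1) K) e
  have h3 : (hyperplane (d + 1) K).chowClass (V := projectiveSpace (d + 1) K) hV =
      (formDivisor (X (Fin.last (d + 1)) : MvPolynomial (Fin (d + 1 + 1)) K) (X_mem K _)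
        (MvPolynomial.X_ne_zero _)).chowClass (V := projectiveSpace (d + 1) K) hV :=
    (hyperplane_linEquiv_formDivisor (X_mem K (Fin.last (d + 1))) (MvPolynomial.X_ne_zero _)).chowClass_eq
      (V := projectiveSpace (d + 1) K) hV
  have h4 : (formDivisor (X (Fin.last (d + 1)) : MvPolynomial (Fin (d + 1 + 1)) K) (X_mem K _)
        (MvPolynomial.X_ne_zero _)).chowClass (V := projectiveSpace (d + 1) K) hV =
      ChowGroup.ofPoint (X := (projectiveSpace (d + 1) K).left)
        (ProjectiveSpaceCells.coordGenericPoint K (n := d + 1) d)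
        (ProjectiveSpaceCells.height_coordGenericPoint K (Nat.le_succ d)) := by
    rw [CartierDivisor.chowClass_def, ChowGroup.ofPoint]
    congr 1
    exact Subtype.ext cycle_formDivisor_X_last
  rw [h1, h2, h3, h4]

/-- **A hypersurface of degree `e` has degree `e`: `deg [V₊(F)] = ∫ c₁(𝒪(1))ᵈ ∩ [V₊(F)] = e`** for a
nonzero form `F` of degree `e` on `ℙ^{d+1}_K`, `K` algebraically closed (Fulton, §2.5 and
Example 2.5.2; the Weil divisor `[V₊(F)]` counts the components of the hypersurface with the
multiplicities of the factors of `F`). [cite: Fulton1998, §2.5 and Example 2.5.2 (p. 41)] -/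
theorem degreeEquiv_chowClass_formDivisor [IsAlgClosed K] {e : ℕ} {F : MvPolynomial (Fin (d + 1 + 1)) K}
    (hF : F ∈ grading (Fin (d + 1 + 1)) K e) (hF0 : F ≠ 0) :
    degreeEquiv (d + 1) (Nat.le_succ d)
        ((formDivisor F hF hF0).chowClass (V := projectiveSpace (d + 1) K) height_top_succ) = e := by
  rw [chowClass_formDivisor_eq_smul hF hF0, map_nsmul,
    degreeEquiv_ofPoint (ProjectiveSpaceCells.isLinearSubspacePoint_coordGenericPoint K (Nat.le_succ d)),
    nsmul_eq_mul, mul_one]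

end ProjSpace

end Literature.AlgebraicGeometry.Motives

end
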